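import Summits.QuantumFields.BalabanUV.T4Continuum.Spine.NE1p.DressedSuppliedBlockAbsorptionWitness

/-!
# T⁴ programme, spine estimate NE1′ (node O3b/H2) — THE MET COMPONENT IS A BOX, PART 1: a decided (γ)-datum whose step-`k` met
# component is the 2⁴-cube BOX of scale `k` — S4 §3's `card_le_of_center_box` ∕ `count_of_anchoring_box` FIRE (their first appliers),
# the component volume `v = vR = 16` is ATTAINED and row S3u §2's supplied END fires with it (crew row W49 ∕ DAG N29zzq; INTENT
# HOME/CLAIMS.log 2026-08-20 l.19370, STAGED l.19531, BOOKED typer R-T125 l.19575 (two parts, (D1)); X-read X162)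

Cell `pub-balaban`, sub-cell `t4`, BINDER-OWNERS row NE1′, crew `b2b-balaban-t4-ne1p-formalise-*`, seat `leaf-02` (gen 14; lineage S3i ∕
S5e ∕ W8 ∕ W32 ∕ W37 ∕ W42).  ADDITIVE — imports W42 PART 1 `Spine/NE1p/DressedSuppliedBlockAbsorptionWitness` (p229669; → W37 → W32 →
row S3u `DressedStabilityStrictOfSuppliedComposition`, W20's push `vmap`, W37's dressing `βR`, W14 PART 1's block arithmetic `Blk` ∕
`coords` ∕ `coords_injective` ∕ `coarsen_coords_zero` ∕ `coarsen_coords_succ` BY NAME) ONLY; toy DATA `def`s + theorems; nothing of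
S3u ∕ S3i ∕ S4 ∕ S5e ∕ W14 ∕ W20 ∕ W32 ∕ W37 ∕ W42 is restated.  PART 2 (`…BoxWitnessEnd`) applies row S3u §2's supplied END, S4 §3's box
count and proves the GENUINENESS records.

WHY.  Row S3u §2's END `dressedStabilityStrict_of_suppliedComposition` carries the met component TWICE as a volume: the housing
component `comp p K k b` with `hvol : #comp ≤ v` and `hvN₀ : v·mB ≤ N₀` (S3i's live count), and the ℝ-step's renormalised component
`(Rs p K).comp b` with `hcv : CompVol vR` (S5e's absorbed count, the window `fanout A·(vR·mB)·(1−ρ′)⁻¹ < 1`).  Row S4 §3 typed the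
K-free form of the volume of a COLLARED met component — `card_le_of_center_box` ∕ `count_of_anchoring_box`: `v = ℓ^d` when the
component's cubes have distinct blocks inside a box of `ℓ` blocks per side (skeleton risk R4, `ℓ` a DISPLAYED binder) — and NO file
applies them; every (γ)-witness of record (W8 ∕ W18 ∕ W20 ∕ W32 ∕ W37 ∕ W42) has ONE cube per component (`CompVol 1`, `hvol … ≤ 1`).
THIS PART decides a datum on which the component IS a box and both volumes EQUAL `2⁴ = 16`:
* §1 `towerX` [decided toy]: at cutoff `K`, births AND cubes `Fin (K+1) × Blk 2` — at every scale `j ≤ K` SIXTEEN families `(j, x)`, one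
  per block `x ∈ {0,1}⁴` (anchored at `coords x` on the scale-`j` block lattice), and SIXTEEN cubes `(k, x)` forming the scale-`k` BOX
  (centre `coords x`); the cube `(k, x)` feels its own new-born family `(k, x)` and — iff it is the CORNER `x = 0` — every family born
  earlier (`felt_under` by the GENUINE coarsening `coarsen 2 (k−j) (coords x′) = 0`, W14); sizes `cX K j · (¼)^(k−j)` with
  `12·cX K j = (1∕32)·(⅛)^(K−j)` (births = the dressing EXACTLY, strictly inside the class `(1∕16)·(⅛)^(K−j)`); ℝ-step `RsX K`: renormalised
  component of `(j, x)` = THE WHOLE scale-`j` BOX (`CompVol 16`), `absorbs := ∅` (see the DESIGN CONSTRAINT below), `pre := ψ·envVar(·, k−1)`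
  (equality seam), `δ := βX`; housing component `compX K k b` = THE WHOLE scale-`k` BOX, live set `SX K k b` = everything born `≤ k`.
* §2 S3u §2's function-level binders (W37∕W42 §2's proofs re-run on the new index type: `hG_X`, `hinv_X`, `hVK_X`∕`hVrel_X`, `hneX_X`∕
  `hsupX_X`, `hreg_X`).
DESIGN CONSTRAINT RECORDED (PART 2 `window_tight` ∕ `no_absorption_at_W37_weight`): with `vR·mB = 16` the window clause
`fanout A·16·(1−ρ′)⁻¹ < 1` forces `A < 1∕32` at `ρ′ = ½` — W37's absorption weight `A = ⅛` is REFUSED by the window at box volume; the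
datum therefore absorbs nothing and carries `A := 1∕64` (window `fanout = ½`, `absorbAmplitude = (1∕32)∕(1−½) = 1∕16 = A₀` TIGHT).

WORDING OF RECORD (typer R-T125 (iii): the title + the rider adopted from the S4 authors' first-refusal wish, leaf-10 l.19505): «THE MET
COMPONENT IS A BOX — S4 §3's `card_le_of_center_box` ∕ `count_of_anchoring_box` FIRE, `CompVol 16` ATTAINED» + RIDER «`ℓ = 2`, `lo = 0`,
`v = 16` are OUR toy numerals (the skeleton's R4 numeral `ℓ` stays a DISPLAYED binder); S4's `card_le_of_center_box` ∕ `count_of_anchoring_box`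
are applied BY NAME with `hbox`∕`hinj` discharged by W14's `coords_injective`» (PART 2 §3: `hbox_X`, `center_inj_X`).

HONEST FRAMING (c4; offered wording).  «Row S3u §2's supplied ENDs fire on a decided (γ)-datum whose met component is the 2⁴-cube box
of its scale: S4 §3's `card_le_of_center_box` ∕ `count_of_anchoring_box` applied (ℓ = 2), `hvol`∕`CompVol` ATTAINED at 16, S3i's live
count ATTAINED at the birth scale by the volume (`N₀ = v·mB = 16`); `Anchoring` (row S3i) ∕ `RStep` (row O3.E-iii-c) are the crew's
SHAPES, the seams equalities BY DEFINITION; SOCKET COMPOSITION certified, NOT that met components ∕ ℝ-operations of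
[Balaban1989LargeFieldII] were constructed or bounded; the skeleton's R4 numeral `ℓ` stays a DISPLAYED binder (the toy's `ℓ = 2` is
OURS); discharges no wall item; the wall line (v1.7) does NOT move; R-t4r2-Q2 NOT met thereby; NE1′ NOT proved.»  [decided toy] ∕
[folklore]; 0 `def … : Prop`; 0 citations.  NE1′ NOT printed, NOT proved; spine PROVED 0∕9; count 9 unchanged.  Rung (B)+1 on ONE finite
four-torus — NOT infinite volume, NOT a mass gap, NOT OS on ℝ⁴, NOT Clay.  HONEST DEPENDENCY: continuum YM on T⁴ ⇐ BetaPertH ∧ nine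
spine estimates (0/9 proved); BetaPertH ⇐ (D1) ∧ (D4) ∧ CAP+tail; G-an2-4 gates asym, D1 and NE2/3/4.
-/

noncomputable section

namespace Summit.QuantumFields.BalabanUV.T4Continuum.NE1p.DressedSuppliedBoxWitness

open Set Metric Finset
open scoped BigOperators
open Literature.MathematicalPhysics.QuantumFieldTheory.Balaban1983to89
open Literature.MathematicalPhysics.QuantumFieldTheory.Balaban1983to89.T4TermFormat
open Literature.MathematicalPhysics.QuantumFieldTheory.Balaban1983to89.T4FeltGeometry
open Literature.MathematicalPhysics.QuantumFieldTheory.Balaban1983to89.T4TrajectoryComparison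
open Literature.MathematicalPhysics.QuantumFieldTheory.Balaban1983to89.T4BirthChartTransport (GaugeInvariant BirthSlice RelGauge)
open Literature.MathematicalPhysics.QuantumFieldTheory.Balaban1983to89.T4PreservedUnderR (RStep)
open Summit.QuantumFields.BalabanUV.T4Continuum.T4TrajectoryDensityDressed
open Summit.QuantumFields.BalabanUV.T4Continuum.NE1p.DressedRoot (DressedTower)
open Summit.QuantumFields.BalabanUV.T4Continuum.NE1p.DressedValueMapWitness (vmap norm_vmap vmap_affine theta_pow_le_one)
open Summit.QuantumFields.BalabanUV.T4Continuum.NE1p.DressedTowerWitnessBlocks (Blk coords coords_injective coarsen_coords_zero coarsen_coords_succ)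

/-! ## §1 The datum: sixteen families and the sixteen-cube BOX at every scale -/

/-- COEFFICIENT of every family born at scale `j` [decided toy]: `12·cX K j = (1∕32)·(⅛)^(K−j)` — the dressing exactly, one sixteenth
of W37's oldest class share (the budget clause `hsmall` at `N₀ = 16` wants `A₀ = 1∕16`). [folklore] -/
def cX (K j : ℕ) : ℝ := (1 / 32 : ℝ) * (1 / 8 : ℝ) ^ (K - j) / 12

/-- [folklore] The law in coefficients. -/
theorem cX_law (K j : ℕ) : 12 * cX K j = (1 / 32 : ℝ) * (1 / 8 : ℝ) ^ (K - j) := by unfold cX; ring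

/-- [folklore] Positivity. -/
theorem cX_pos (K j : ℕ) : 0 < cX K j := by unfold cX; positivity

/-- THE INDEX TYPE [decided toy]: (scale, block) — births AND cubes. [folklore] -/
abbrev Ix (K : ℕ) : Type := Fin (K + 1) × Blk 2

/-- BOOKED SIZE [decided toy]: coefficient × the pushed unit defect `(¼)^(k−j_b)`. [folklore] -/
def sizeX (K : ℕ) (b : Ix K) (k : ℕ) : ℝ := cX K b.1.val * (1 / 4 : ℝ) ^ (k - b.1.val)

/-- [folklore] Booked sizes are positive. -/
theorem sizeX_pos (K : ℕ) (b : Ix K) (k : ℕ) : 0 < sizeX K b k := mul_pos (cX_pos K _) (by positivity)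

/-- FELT FAMILIES of the cube `(k, x)` [decided toy]: its own new-born family `(k, x)`, and — at the CORNER `x = 0` only — every family
born at an earlier scale (whose block coarsens to the corner). [folklore] -/
def feltX (K : ℕ) (q : Ix K) : Finset (Ix K) :=
  Finset.univ.filter fun b => b = q ∨ (q.2 = 0 ∧ b.1.val < q.1.val)

/-- [folklore] Felt families are born no later than the cube's scale. -/
theorem feltX_scale (K : ℕ) (q : Ix K) : ∀ b ∈ feltX K q, b.1.val ≤ q.1.val := fun b hb => by
  rcases (Finset.mem_filter.mp hb).2 with h | h
  · rw [h]
  · exact h.2.le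

/-- THE BOOKING at cutoff `K` [decided toy]: births = cubes = `Fin (K+1) × Blk 2`, scale = first coordinate, felt sets `feltX`, sizes `sizeX`. [folklore] -/
def BX (K : ℕ) : T4TermFormat.Booking where
  K := K
  Dom := Ix K
  domScale := fun X => X.1.val
  treeLen := fun _ => 0
  treeLen_nonneg := fun _ => le_rfl
  balSize := fun _ => 0
  Birth := Ix K
  births := Finset.univ
  mem_births := fun b => Finset.mem_univ b
  birthScale := fun b => b.1.val
  birth_le := fun b => Nat.lt_succ_iff.mp b.1.isLt
  loc := fun b => b
  loc_scale := fun _ => rfl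
  Cube := Ix K
  cubes := Finset.univ
  mem_cubes := fun q => Finset.mem_univ q
  cubeScale := fun q => q.1.val
  cube_le := fun q => Nat.lt_succ_iff.mp q.1.isLt
  feltAt := feltX K
  felt_birth_le := feltX_scale K
  size := sizeX K
  size_nonneg := fun b k => (sizeX_pos K b k).le
  pair := fun _ _ _ => 0

/-- THE TRAJECTORY [decided toy]: one generation per family, birth size `3·cX`, re-linearised size = the booked size; births only. [folklore] -/
def TX (K : ℕ) : Trajectory (BX K) where
  lin := fun b k' k => if k' = b.1.val then sizeX K b k else 0
  lin_nonneg := fun b k' k => by split_ifs <;> [exact (sizeX_pos K b k).le; exact le_rfl]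
  gen := fun b k' => if k' = b.1.val then 3 * cX K b.1.val else 0
  gen_nonneg := fun b k' => by split_ifs <;> [exact (mul_pos (by norm_num) (cX_pos K _)).le; exact le_rfl]
  size_le := fun b k hbk _ => by
    change b.1.val ≤ k at hbk
    show sizeX K b k ≤ ∑ k' ∈ Icc b.1.val k, (if k' = b.1.val then sizeX K b k else 0)
    rw [Finset.sum_ite_eq' (Icc b.1.val k) b.1.val (fun _ => sizeX K b k), if_pos (Finset.mem_Icc.mpr ⟨le_rfl, hbk⟩)]

/-- THE TOWER [decided toy]. [folklore] -/
def towerX : DressedTower Unit where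
  B := fun _ K => BX K
  K_eq := fun _ _ => rfl
  T := fun _ K => TX K

/-- THE CARRIED FUNCTION of generation `k′` of family `b` [decided toy]: the birth generation is `U ↦ cX · U`; none later. [folklore] -/
def FnX (K : ℕ) (b : Ix K) (k' : ℕ) (U : ℂ) : ℂ := if k' = b.1.val then (cX K b.1.val : ℂ) * U else 0

/-- THE BOX of scale `k` [decided toy]: all sixteen cubes of scale `k` (empty above the cutoff). [folklore] -/
def boxX (K k : ℕ) : Finset (Ix K) := Finset.univ.filter fun q => q.1.val = k

/-- [folklore] Membership in the box. -/
theorem mem_boxX {K k : ℕ} {q : Ix K} : q ∈ boxX K k ↔ q.1.val = k := by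
  unfold boxX; rw [Finset.mem_filter]; exact ⟨fun h => h.2, fun h => ⟨Finset.mem_univ _, h⟩⟩

/-- [folklore] Membership in a felt set. -/
theorem mem_feltX {K : ℕ} {q b : Ix K} : b ∈ feltX K q ↔ b = q ∨ (q.2 = 0 ∧ b.1.val < q.1.val) := by
  unfold feltX; rw [Finset.mem_filter]; exact ⟨fun h => h.2, fun h => ⟨Finset.mem_univ _, h⟩⟩

/-- THE LIVE FAMILIES of a step-`k` component [decided toy]: everything born `≤ k`; none above the cutoff. [folklore] -/
def SX (K k : ℕ) (_b : Ix K) : Finset (Ix K) := if k ≤ K then Finset.univ.filter (fun f => f.1.val ≤ k) else ∅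

/-- THE HOUSING COMPONENT of a step-`k` family [decided toy]: THE BOX of scale `k`. [folklore] -/
def compX (K k : ℕ) (_b : Ix K) : Finset (Ix K) := boxX K k

/-- THE ANCHORING on `ℕ⁴` at the blocking integer `2` [decided toy]: family `(j, x)` at the block `coords x`, cube `(k, x)` centred at
`coords x` — `felt_under` at the corner through the GENUINE coarsening `coarsen 2 (n+1) (coords x′) = 0` (W14's `coarsen_coords_succ`). [folklore] -/
def anchX (K : ℕ) : Anchoring (BX K) 4 2 where
  dom := fun b => {coords b.2}
  center := fun q => coords q.2
  felt_under := fun q b hb => by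
    refine ⟨coords b.2, mem_singleton_self _, ?_⟩
    rcases (Finset.mem_filter.mp hb).2 with h | ⟨hq0, hlt⟩
    · rw [h]
      show coarsen 2 (q.1.val - q.1.val) (coords q.2) = coords q.2
      rw [Nat.sub_self]; exact coarsen_coords_zero q.2
    · show coarsen 2 (q.1.val - b.1.val) (coords b.2) = coords q.2
      obtain ⟨n, hn⟩ : ∃ n, q.1.val - b.1.val = n + 1 := ⟨q.1.val - b.1.val - 1, by omega⟩
      rw [hn, coarsen_coords_succ, hq0]
      rfl

/-- PRE-ℝ SIZE before the ℝ-operation of scale `k` [decided toy]: the rate times the dressed envelope at `k−1` (EQUALITY seam). [folklore] -/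
def preX (K : ℕ) (b : Ix K) (k : ℕ) : ℝ :=
  (((2 : ℝ) ^ 2)⁻¹ * 1) * (TX K).envVar (4 * 1 / 1) (fun _ : ℕ => ((2 : ℝ) ^ 2)⁻¹ * 1) b (k - 1)

/-- THE DRESSING [decided toy]: `βX K j = (1∕32)·(⅛)^(K−j)` — the whole birth class share (nothing is absorbed). [folklore] -/
def βX (K j : ℕ) : ℝ := (1 / 32 : ℝ) * ((2 : ℝ)⁻¹ ^ 3) ^ (K - j)

/-- THE ℝ-STEP DATUM [decided toy]: `pre = preX`, `absorbs = ∅`, renormalised component = THE BOX of the birth scale, `δ = βX`. [folklore] -/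
def RsX (K : ℕ) : RStep (BX K) where
  pre := preX K
  pre_nonneg := fun b k => mul_nonneg (by norm_num) (Trajectory.envVar_nonneg (by norm_num) (fun _ => by norm_num) b (k - 1))
  absorbs := fun _ => ∅
  absorbs_lt := fun _ _ hb => absurd hb (Finset.notMem_empty _)
  comp := fun b => boxX K b.1.val
  comp_scale := fun b q hq => (Finset.mem_filter.mp hq).2
  absorbs_felt := fun _ _ hb => absurd hb (Finset.notMem_empty _)
  δ := fun b => βX K b.1.val
  δ_nonneg := fun b => by unfold βX; positivity

/-! ## §2 Row S3u §2's function-level binders on the datum (W37∕W42 §2's proofs on the new index type) -/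

/-- **F-1 AT BIRTH** [decided toy]: a `BirthSlice` along the affine chart (window `1`, radius `1`, `closedBall 0 1`), SHARP sup `3·cX`; any history. [folklore] -/
theorem hG_X (K : ℕ) (Gate : ℕ → Prop) : ∀ (b : (BX K).Birth) (k' : ℕ), (BX K).birthScale b ≤ k' → k' ≤ (BX K).K →
    RanBelow Gate k' → BirthSlice (FnX K b k') (fun U d t => U + t * d) (fun d : ℂ => ‖d‖) (closedBall (0 : ℂ) 1) 1 1 ((TX K).gen b k') := by
  intro b k' _ _ _ U hU d hd hdw
  show ∃ Dm : Set ℂ, DifferentiableOn ℂ (fun t : ℂ => FnX K b k' (U + t * d)) Dm ∧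
      (∀ t ∈ Dm, ‖FnX K b k' (U + t * d)‖ ≤ (if k' = b.1.val then 3 * cX K b.1.val else 0)) ∧
      ∀ s ∈ Set.Icc (0 : ℝ) 1, closedBall (s : ℂ) (1 / ‖d‖) ⊆ Dm
  by_cases hk' : k' = b.1.val
  · refine ⟨closedBall (0 : ℂ) (1 + 1 / ‖d‖), ?_, ?_, ?_⟩
    · unfold FnX
      simp only [if_pos hk']
      exact ((differentiable_const _).mul ((differentiable_const _).add
        (differentiable_id.mul (differentiable_const _)))).differentiableOn
    · intro t ht
      rw [if_pos hk']
      unfold FnX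
      rw [if_pos hk', norm_mul, Complex.norm_real, Real.norm_of_nonneg (cX_pos K _).le, mul_comm]
      refine mul_le_mul_of_nonneg_right ?_ (cX_pos K _).le
      have htd : ‖t‖ * ‖d‖ ≤ (1 + 1 / ‖d‖) * ‖d‖ := mul_le_mul_of_nonneg_right (mem_closedBall_zero_iff.mp ht) (norm_nonneg d)
      rw [add_mul, one_mul, one_div, inv_mul_cancel₀ hd.ne'] at htd
      calc ‖U + t * d‖ ≤ ‖U‖ + ‖t‖ * ‖d‖ := (norm_add_le _ _).trans (by rw [norm_mul])
        _ ≤ 1 + (‖d‖ + 1) := add_le_add (mem_closedBall_zero_iff.mp hU) htd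
        _ ≤ 3 := by linarith
    · intro s hs t ht
      rw [mem_closedBall, dist_eq_norm] at ht
      have h2 : ‖(s : ℂ)‖ ≤ 1 := by rw [Complex.norm_real, Real.norm_of_nonneg hs.1]; exact hs.2
      rw [mem_closedBall_zero_iff]
      calc ‖t‖ = ‖t - (s : ℂ) + (s : ℂ)‖ := by rw [sub_add_cancel]
        _ ≤ ‖t - (s : ℂ)‖ + ‖(s : ℂ)‖ := norm_add_le _ _
        _ ≤ 1 / ‖d‖ + 1 := add_le_add ht h2
        _ = 1 + 1 / ‖d‖ := add_comm _ _
  · refine ⟨Set.univ, ?_, ?_, fun _ _ => Set.subset_univ _⟩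
    · unfold FnX
      simp only [if_neg hk']
      exact differentiableOn_const 0
    · intro t _
      unfold FnX
      simp [hk']

/-- `hinv`: invariance under the trivial relation. [folklore] -/
theorem hinv_X (K : ℕ) (b : (BX K).Birth) (k' : ℕ) : GaugeInvariant (fun U U' : ℂ => U = U') (FnX K b k') := fun _ _ h => by rw [h]

/-- `hVK` — containment of W20's push. [folklore] -/
theorem hVK_X (K : ℕ) : ∀ (b : (BX K).Birth) (k' k : ℕ), (BX K).birthScale b ≤ k' → k' ≤ k → k ≤ (BX K).K →
    ∀ X₀ ∈ closedBall (0 : ℂ) 1, vmap k' k X₀ ∈ closedBall (0 : ℂ) 1 := by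
  intro b k' k _ _ _ X₀ hX₀
  rw [mem_closedBall_zero_iff] at hX₀ ⊢
  rw [norm_vmap]
  calc (1 / 4 : ℝ) ^ (k - k') * ‖X₀‖ ≤ 1 * 1 := mul_le_mul (theta_pow_le_one _) hX₀ (norm_nonneg _) zero_le_one
    _ = 1 := one_mul _

/-- `hVrel` — felt-size contraction PERFORMED by W20's push. [folklore] -/
theorem hVrel_X (K : ℕ) : ∀ (b : (BX K).Birth) (k' k : ℕ), (BX K).birthScale b ≤ k' → k' ≤ k → k ≤ (BX K).K →
    ∀ X₀ ∈ closedBall (0 : ℂ) 1, ∀ X₁ : ℂ, ∀ δ : ℝ,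
      RelGauge (fun U U' : ℂ => U = U') (fun U d t => U + t * d) (fun d : ℂ => ‖d‖) X₀ X₁ δ →
      RelGauge (fun U U' : ℂ => U = U') (fun U d t => U + t * d) (fun d : ℂ => ‖d‖) (vmap k' k X₀) (vmap k' k X₁)
        ((1 / 4 : ℝ) ^ (k - k') * δ) := by
  intro b k' k _ _ _ X₀ _ X₁ δ h
  obtain ⟨d, hd0, hdδ, hX₁⟩ := h
  refine ⟨vmap k' k d, ?_, ?_, ?_⟩
  · show 0 < ‖vmap k' k d‖
    rw [norm_vmap]; exact mul_pos (by positivity) hd0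
  · show ‖vmap k' k d‖ ≤ (1 / 4 : ℝ) ^ (k - k') * δ
    rw [norm_vmap]; exact mul_le_mul_of_nonneg_left hdδ (by positivity)
  · show vmap k' k X₁ = vmap k' k X₀ + 1 * vmap k' k d
    rw [show X₁ = X₀ + 1 * d from hX₁, vmap_affine]

/-- `hneX` — admissible unit pairs exist; any history. [folklore] -/
theorem hneX_X (K : ℕ) (Gate : ℕ → Prop) : ∀ (b : (BX K).Birth) (k' k : ℕ), (BX K).birthScale b ≤ k' → k' ≤ k → k ≤ (BX K).K →
    RanBelow Gate k → ∃ X₀ ∈ closedBall (0 : ℂ) 1, ∃ X₁ : ℂ,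
      RelGauge (fun U U' : ℂ => U = U') (fun U d t => U + t * d) (fun d : ℂ => ‖d‖) X₀ X₁ ((fun _ : ℕ => (1 : ℝ)) k) :=
  fun _ _ _ _ _ _ _ => ⟨0, mem_closedBall_self zero_le_one, 0 + 1 * 1, 1, by simp, by simp, rfl⟩

/-- [folklore] The composed increment over a scale-`k` unit pair: `≤ cX · θ^(k−k′)` for the birth generation, `0` otherwise. -/
theorem composed_increment_le (K : ℕ) (b : (BX K).Birth) (k' k : ℕ) {X₀ X₁ : ℂ}
    (h : RelGauge (fun U U' : ℂ => U = U') (fun U d t => U + t * d) (fun d : ℂ => ‖d‖) X₀ X₁ 1) :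
    ‖FnX K b k' (vmap k' k X₁) - FnX K b k' (vmap k' k X₀)‖ ≤ if k' = b.1.val then cX K b.1.val * (1 / 4 : ℝ) ^ (k - k') else 0 := by
  obtain ⟨d, _, hd1, hX₁⟩ := h
  have hX : X₁ = X₀ + 1 * d := hX₁
  unfold FnX
  by_cases hk' : k' = b.1.val
  · rw [if_pos hk', if_pos hk', if_pos hk', ← mul_sub, hX, vmap_affine, add_sub_cancel_left, one_mul, norm_mul,
      Complex.norm_real, Real.norm_of_nonneg (cX_pos K _).le, norm_vmap]
    refine mul_le_mul_of_nonneg_left ?_ (cX_pos K _).le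
    calc (1 / 4 : ℝ) ^ (k - k') * ‖d‖ ≤ (1 / 4 : ℝ) ^ (k - k') * 1 := mul_le_mul_of_nonneg_left hd1 (by positivity)
      _ = (1 / 4 : ℝ) ^ (k - k') := mul_one _
  · rw [if_neg hk', if_neg hk', if_neg hk', sub_zero, norm_zero]

/-- [folklore] … and the UNIT pair `(0, 1)` ATTAINS it. -/
theorem composed_increment_unit (K : ℕ) (b : (BX K).Birth) (k : ℕ) :
    ‖FnX K b b.1.val (vmap b.1.val k (0 + 1 * 1)) - FnX K b b.1.val (vmap b.1.val k 0)‖ = sizeX K b k := by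
  unfold FnX sizeX
  rw [if_pos rfl, if_pos rfl, zero_add, one_mul, ← mul_sub]
  unfold vmap
  rw [mul_zero, mul_one, sub_zero, norm_mul, Complex.norm_real, Complex.norm_real, Real.norm_of_nonneg (cX_pos K _).le,
    Real.norm_of_nonneg (by positivity)]

/-- `hsupX` — the booking convention on unit pairs, ATTAINED; any history. [folklore] -/
theorem hsupX_X (K : ℕ) (Gate : ℕ → Prop) : ∀ (b : (BX K).Birth) (k' k : ℕ), (BX K).birthScale b ≤ k' → k' ≤ k → k ≤ (BX K).K →
    RanBelow Gate k → (TX K).lin b k' k ≤ sSup {x : ℝ | ∃ X₀ ∈ closedBall (0 : ℂ) 1, ∃ X₁ : ℂ,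
      RelGauge (fun U U' : ℂ => U = U') (fun U d t => U + t * d) (fun d : ℂ => ‖d‖) X₀ X₁ ((fun _ : ℕ => (1 : ℝ)) k) ∧
        x = ‖FnX K b k' (vmap k' k X₁) - FnX K b k' (vmap k' k X₀)‖} := by
  intro b k' k _ _ _ _
  have hbdd : BddAbove {x : ℝ | ∃ X₀ ∈ closedBall (0 : ℂ) 1, ∃ X₁ : ℂ,
      RelGauge (fun U U' : ℂ => U = U') (fun U d t => U + t * d) (fun d : ℂ => ‖d‖) X₀ X₁ ((fun _ : ℕ => (1 : ℝ)) k) ∧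
        x = ‖FnX K b k' (vmap k' k X₁) - FnX K b k' (vmap k' k X₀)‖} := by
    refine ⟨if k' = b.1.val then cX K b.1.val * (1 / 4 : ℝ) ^ (k - k') else 0, ?_⟩
    rintro x ⟨X₀, -, X₁, hrel, rfl⟩
    exact composed_increment_le K b k' k hrel
  show (if k' = b.1.val then sizeX K b k else 0) ≤ _
  by_cases hk' : k' = b.1.val
  · rw [if_pos hk']
    refine le_csSup hbdd ⟨0, mem_closedBall_self zero_le_one, 0 + 1 * 1, ⟨1, by simp, by simp, rfl⟩, ?_⟩
    rw [hk', composed_increment_unit]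
  · rw [if_neg hk']
    exact Real.sSup_nonneg (by rintro x ⟨_, -, _, -, rfl⟩; exact norm_nonneg _)

/-- (w5) `hreg`: births only (idle, as W18∕W37∕W42); any history. [folklore] -/
theorem hreg_X (K : ℕ) (Gate : ℕ → Prop) : (TX K).RegeneratesFromVar (fun _ : ℕ => (0 : ℝ)) Gate := by
  intro b k hbk _ _
  show (if k + 1 = b.1.val then 3 * cX K b.1.val else 0) ≤ 0 * sizeX K b k
  have hne : k + 1 ≠ b.1.val := by change b.1.val ≤ k at hbk; omega
  rw [if_neg hne, zero_mul]

end Summit.QuantumFields.BalabanUV.T4Continuum.NE1p.DressedSuppliedBoxWitness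

end
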